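import Literature.AnabelianGeometry.EtaleTheta.Discharge.Sec5Prop53ChainModel
import Literature.AnabelianGeometry.EtaleTheta.Discharge.Sec5Prop53Coordinates
import Literature.AnabelianGeometry.EtaleTheta.Discharge.Sec5Prop53ThetaOrbitOrders

/-!
# [EtTh] §5, Prop. 5.3 (ii), (iii), (vi): the binders of the NON-VACUOUS instance forms (`…_of_coordinates`,
# `…_of_orders`) are JOINTLY SATISFIED at the chain model — a datum with PERFECT `Φ(A_⊚)` and non-trivial `Aut_C(A_⊚)`-action
# (non-vacuity certificate for rows F-0562 / F-0559 / F-0564)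

Mochizuki, *The étale theta function …*, Publ. RIMS **45** (2009), §5, Prop. 5.3 (ii), (iii), (vi), pp. 325–327 (PDF pp.
99–101) [cite: MochizukiEtTh2009, Prop 5.3 p.325 (PDF p.99)].  Cell abc-iut, block F, seat abc-iut-f-128 (tranche 128).
PROOF-ONLY over this seat's `Sec5Prop53ChainModel.lean` (the chain model `chainTheta`, `Φ(A_⊚) = ⊕_{ℤ ⊔ ℤ} ℚ_{≥0}`, base
automorphisms translating the chain; f-009's toy objects `P`, `idx`, `label`, `canonIso`, `reindex`),
`Sec5Prop53Coordinates.lean` (`preserves{N,C}spComponentIsos_of_coordinates`, p436610) and `Sec5Prop53ThetaOrbitOrders.lean`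
(`preservesThetaDivisorOrbit_of_orders`, p437011).  Two small plumbing `def`s (`coordAt`, `ordAt`: the `i`-th coefficient of
`⊕ ℚ_{≥0}` read in `ℚ`, and its extension to `Φ^gp`) — no `Prop` fact, no instance.

WHY.  abc-iut-f-127 (p434934) proved the instance forms of record of (ii)/(iii)/(vi) VACUOUS when `Φ(A_⊚)` is perfect (Prop.
5.1).  The replacement forms take binders instead of the `ℤ_{≥0}`-structure; this file checks that ALL their binders hold
simultaneously at ONE datum whose `Φ(A_⊚)` is perfect (`⊕ ℚ_{≥0}`) and whose `Aut_C(A_⊚) ≅ ℤ` acts non-trivially, for every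
chain automorphism `e = reindex (chainAut ε c)`: coordinates `φ_𝔭 =` the `idx 𝔭`-coefficient, i.e. the tree's
`DirectSum.submonoidEquiv` (`coordinates_binders_chain`),
orders `ord_𝔭 =` the `idx 𝔭`-coefficient on `Φ^gp` with `θ = 𝟙_{0}`, `s = 0`, `κ = 0` (`orders_binders_chain`), and re-derives
(ii), (iii), (vi) at the model THROUGH the new forms (`…_viaCoordinates`, `…_viaOrders`).
HONEST FRAMING: a toy datum; nothing about the tempered Frobenioid of §5 or [IUTchIII] Cor. 3.12; no side taken; typed ≠ proved.
-/

namespace Literature.AnabelianGeometry.EtaleTheta.FrobenioidThetaDivisors.Prop53Chain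

open CategoryTheory Literature.AlgebraicGeometry.Frobenioids ConstantMultiple ConstantMultiple.Cor512Toy Prop53Toy

/-! ### Coordinates: the binders of `preserves{N,C}spComponentIsos_of_coordinates` at the chain model -/

/-- The canonical isomorphisms preserve the coefficient (`hiso`). [cite: MochizukiEtTh2009, Prop 5.3 (ii) p.325 (PDF p.99)] -/
theorem coeff_canonIso (𝔭 𝔮 : Primes Φt) (x : ↥𝔭.submonoid) :
    (((canonIso 𝔭 𝔮 x : ↥𝔮.submonoid) : Φt) : ∀ j, Fac j) (idx 𝔮) = ((x : Φt) : ∀ j, Fac j) (idx 𝔭) := by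
  rw [canonIso_val, DirectSum.single_apply_same]

/-- A re-indexing preserves the coefficient (`hψ`): the `idx (ψ𝔭)`-coefficient of `ψ x` is the `idx 𝔭`-coefficient of `x`.
[cite: MochizukiEtTh2009, Prop 5.3 (ii) p.325 (PDF p.99)] -/
theorem coeff_submonoidCongr (σ : Idx ≃ Idx) (ψ : Φt ≃* Φt) (hψ : ψ = reindex σ) (𝔭 : Primes Φt) (x : ↥𝔭.submonoid) :
    (((Primes.submonoidCongr ψ 𝔭 _ rfl x : ↥(Primes.congr ψ 𝔭).submonoid) : Φt) : ∀ j, Fac j) (idx (Primes.congr ψ 𝔭)) =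
      ((x : Φt) : ∀ j, Fac j) (idx 𝔭) := by
  subst hψ
  rw [Primes.coe_submonoidCongr_apply, idx_congr_reindex, reindex_apply, Equiv.symm_apply_apply]

/-- **The binders of the coordinate forms hold at the chain model**, for every `e = reindex (chainAut ε c)`: injective
coordinates into `L := ℚ_{≥0}`, `hiso` for BOTH families of component isomorphisms, `hψ` for `Ψ^Φ_{A_⊚}`.
[cite: MochizukiEtTh2009, Prop 5.3 (ii) p.325 (PDF p.99)] -/
theorem coordinates_binders_chain (ε : ℤˣ) (c : ℤ) :
    ∃ φ : ∀ 𝔭 : Primes chainTheta.PhiAcirc, ↥𝔭.submonoid → Multiplicative NNRat,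
      (∀ 𝔭, Function.Injective (φ 𝔭)) ∧
      (∀ (p q : Primes chainTheta.PhiAcirc) (hp : ¬ chainPrimeData.IsCuspidal p) (hq : ¬ chainPrimeData.IsCuspidal q)
        (x : ↥p.submonoid), φ q (chainPrimeData.ncspIso p q hp hq x) = φ p x) ∧
      (∀ (p q : Primes chainTheta.PhiAcirc) (hp : chainPrimeData.IsCuspidal p) (hq : chainPrimeData.IsCuspidal q)
        (x : ↥p.submonoid), φ q (chainPrimeData.cspIso p q hp hq x) = φ p x) ∧
      (∀ (p : Primes chainTheta.PhiAcirc) (x : ↥p.submonoid),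
        φ _ (Primes.submonoidCongr (psiPhi chainTheta Ψ₁ ι₁ (reindex (chainAut ε c))) p _ rfl x) = φ p x) :=
  ⟨fun 𝔭 => ⇑(DirectSum.submonoidEquiv fac_monoprime 𝔭 (idx 𝔭) (P_idx 𝔭)),
    fun 𝔭 => (DirectSum.submonoidEquiv fac_monoprime 𝔭 (idx 𝔭) (P_idx 𝔭)).injective, fun p q _ _ x => coeff_canonIso p q x,
    fun p q _ _ x => coeff_canonIso p q x, fun p x => coeff_submonoidCongr (chainAut ε c) _ (psiPhi_chain _) p x⟩

/-- (ii) at the chain model THROUGH the coordinate form `preservesNcspComponentIsos_of_coordinates` (p436610).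
[cite: MochizukiEtTh2009, Prop 5.3 (ii) p.325 (PDF p.99)] -/
theorem preservesNcspComponentIsos_chain_viaCoordinates (ε : ℤˣ) (c : ℤ) :
    Literature.AnabelianGeometry.EtaleTheta.FrobenioidThetaDivisors.PreservesNcspComponentIsos chainPrimeData Ψ₁ ι₁
      (reindex (chainAut ε c)) (cuspPreserved_chain ε c) :=
  preservesNcspComponentIsos_of_coordinates chainPrimeData Ψ₁ ι₁ _ (cuspPreserved_chain ε c)
    (fun 𝔭 => ⇑(DirectSum.submonoidEquiv fac_monoprime 𝔭 (idx 𝔭) (P_idx 𝔭)))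
    (fun 𝔭 => (DirectSum.submonoidEquiv fac_monoprime 𝔭 (idx 𝔭) (P_idx 𝔭)).injective) (fun p q _ _ x => coeff_canonIso p q x)
    fun p x => coeff_submonoidCongr (chainAut ε c) _ (psiPhi_chain _) p x

/-- (iii) at the chain model THROUGH the coordinate form `preservesCspComponentIsos_of_coordinates` (p436610).
[cite: MochizukiEtTh2009, Prop 5.3 (iii) p.325 (PDF p.99)] -/
theorem preservesCspComponentIsos_chain_viaCoordinates (ε : ℤˣ) (c : ℤ) :
    Literature.AnabelianGeometry.EtaleTheta.FrobenioidThetaDivisors.PreservesCspComponentIsos chainPrimeData Ψ₁ ι₁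
      (reindex (chainAut ε c)) (cuspPreserved_chain ε c) :=
  preservesCspComponentIsos_of_coordinates chainPrimeData Ψ₁ ι₁ _ (cuspPreserved_chain ε c)
    (fun 𝔭 => ⇑(DirectSum.submonoidEquiv fac_monoprime 𝔭 (idx 𝔭) (P_idx 𝔭)))
    (fun 𝔭 => (DirectSum.submonoidEquiv fac_monoprime 𝔭 (idx 𝔭) (P_idx 𝔭)).injective) (fun p q _ _ x => coeff_canonIso p q x)
    fun p x => coeff_submonoidCongr (chainAut ε c) _ (psiPhi_chain _) p x

/-! ### Orders on `Φ(A_⊚)^gp`: the binders of `preservesThetaDivisorOrbit_of_orders` at the chain model -/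

/-- The `i`-th coefficient `⊕_{ℤ ⊔ ℤ} ℚ_{≥0} → ℚ` (into the multiplicatively written additive group `ℚ`).
[cite: MochizukiEtTh2009, Prop 3.2 (i) p.296 (PDF p.70)] -/
noncomputable def coordAt (i : Idx) : Φt →* Multiplicative ℚ :=
  (AddMonoidHom.toMultiplicative (NNRat.coeHom : ℚ≥0 →+* ℚ).toAddMonoidHom).comp
    ((Pi.evalMonoidHom Fac i).comp (directSum Fac).subtype)

/-- `coordAt i a` is the `i`-th coefficient of `a`, cast to `ℚ`. [cite: MochizukiEtTh2009, Prop 3.2 (i) p.296 (PDF p.70)] -/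
theorem toAdd_coordAt (i : Idx) (a : Φt) :
    Multiplicative.toAdd (coordAt i a) = ((Multiplicative.toAdd ((a : ∀ j, Fac j) i) : ℚ≥0) : ℚ) := rfl

/-- The order at `𝔭` on `Φ(A_⊚)^gp`: the `idx 𝔭`-coefficient extended to the Grothendieck group, read additively in `ℚ`.
[cite: MochizukiEtTh2009, Prop 5.3 proof p.326 (PDF p.100)] -/
noncomputable def ordAt (𝔭 : Primes Φt) (x : Algebra.GrothendieckGroup Φt) : ℚ :=
  Multiplicative.toAdd (Algebra.GrothendieckGroup.lift (coordAt (idx 𝔭)) x)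

/-- `lift f [m] = f m` (Mathlib's universal property, pointwise). [folklore] -/
private theorem lift_of {M : Type*} [CommMonoid M] {G : Type*} [CommGroup G] (f : M →* G) (m : M) :
    Algebra.GrothendieckGroup.lift f (Algebra.GrothendieckGroup.of m) = f m := by
  have h := Algebra.GrothendieckGroup.lift.symm_apply_apply f
  rw [Algebra.GrothendieckGroup.lift_symm_apply] at h
  exact DFunLike.congr_fun h m

/-- Every element of a Grothendieck group is a fraction. [folklore] -/
private theorem exists_eq_of_div_of {M : Type*} [CommMonoid M] (z : Algebra.GrothendieckGroup M) :
    ∃ a b : M, z = Algebra.GrothendieckGroup.of a / Algebra.GrothendieckGroup.of b := by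
  induction z using Localization.induction_on with
  | H y =>
    refine ⟨y.1, y.2, eq_div_iff_mul_eq'.mpr ?_⟩
    rw [Localization.mk_eq_monoidOf_mk'_apply]
    exact Submonoid.LocalizationMap.mk'_spec _ _ _

/-- `ord_𝔭 [a] =` the `idx 𝔭`-coefficient of `a`. [cite: MochizukiEtTh2009, Prop 5.3 proof p.326 (PDF p.100)] -/
theorem ordAt_of (𝔭 : Primes Φt) (a : Φt) :
    ordAt 𝔭 (Algebra.GrothendieckGroup.of a) = ((Multiplicative.toAdd ((a : ∀ j, Fac j) (idx 𝔭)) : ℚ≥0) : ℚ) := by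
  rw [ordAt, lift_of, toAdd_coordAt]

/-- `ord_𝔭 ([a]/[b]) = a_{idx 𝔭} − b_{idx 𝔭}`. [cite: MochizukiEtTh2009, Prop 5.3 proof p.326 (PDF p.100)] -/
theorem ordAt_div_of (𝔭 : Primes Φt) (a b : Φt) :
    ordAt 𝔭 (Algebra.GrothendieckGroup.of a / Algebra.GrothendieckGroup.of b) =
      ((Multiplicative.toAdd ((a : ∀ j, Fac j) (idx 𝔭)) : ℚ≥0) : ℚ) -
        ((Multiplicative.toAdd ((b : ∀ j, Fac j) (idx 𝔭)) : ℚ≥0) : ℚ) := by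
  rw [← ordAt_of, ← ordAt_of, ordAt, ordAt, ordAt, map_div, toAdd_div]

/-- **The orders separate `Φ(A_⊚)^gp`** (`hsep`; Prop. 3.2 (i): the product-valued factorization is injective).
[cite: MochizukiEtTh2009, Prop 3.2 (i) p.296 (PDF p.70)] -/
theorem ordAt_separating (x y : Algebra.GrothendieckGroup Φt) (h : ∀ 𝔭, ordAt 𝔭 x = ordAt 𝔭 y) : x = y := by
  obtain ⟨a, b, rfl⟩ := exists_eq_of_div_of x
  obtain ⟨c, d, rfl⟩ := exists_eq_of_div_of y
  rw [div_eq_div_iff_mul_eq_mul, ← map_mul, ← map_mul]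
  refine congrArg Algebra.GrothendieckGroup.of (Subtype.ext (funext fun i => ?_))
  have hi := h (P i)
  rw [ordAt_div_of, ordAt_div_of, idx_P, sub_eq_sub_iff_add_eq_add, ← NNRat.coe_add, ← NNRat.coe_add,
    NNRat.coe_inj, ← toAdd_mul, ← toAdd_mul, Multiplicative.toAdd.injective.eq_iff] at hi
  exact hi

/-- `(reindex σ)⁻¹ = reindex σ⁻¹`. [cite: MochizukiEtTh2009, Prop 5.3 p.325 (PDF p.99)] -/
theorem reindex_symm (σ : Idx ≃ Idx) : (reindex σ).symm = reindex σ.symm := rfl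

/-- **Transport of orders under a re-indexing**: `ord_𝔮 (ψ^gp x) = ord_{ψ⁻¹𝔮} x` for `ψ = reindex σ` (`hψo`, and the order part
of `hAut`). [cite: MochizukiEtTh2009, Prop 5.3 proof p.326 (PDF p.100)] -/
theorem ordAt_gpMap_reindex (σ : Idx ≃ Idx) (ψ : Φt ≃* Φt) (hψ : ψ = reindex σ) (𝔮 : Primes Φt)
    (x : Algebra.GrothendieckGroup Φt) :
    ordAt 𝔮 (ThetaFrobenioid.gpMap (ψ : Φt →* Φt) x) = ordAt (Primes.congr ψ.symm 𝔮) x := by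
  subst hψ
  have key : (Algebra.GrothendieckGroup.lift (coordAt (idx 𝔮))).comp (ThetaFrobenioid.gpMap (reindex σ : Φt →* Φt)) =
      Algebra.GrothendieckGroup.lift (coordAt (idx (Primes.congr (reindex σ).symm 𝔮))) :=
    DivisorSupportData.gpHom_ext fun a => by
      rw [MonoidHom.comp_apply, ThetaFrobenioid.gpMap_of, lift_of, lift_of, MonoidHom.coe_coe, reindex_symm,
        idx_congr_reindex]
      apply Multiplicative.toAdd.injective
      rw [toAdd_coordAt, toAdd_coordAt, reindex_apply]
  exact congrArg Multiplicative.toAdd (DFunLike.congr_fun key x)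

/-- The profile `θ = 𝟙_{0}` of `div(Θ̈) = [x_{inl 0}]` on the components: order `1` at the component of label `0`, else `0`.
[cite: MochizukiEtTh2009, Prop 5.3 (vi) p.326 (PDF p.100)] -/
theorem ordAt_divTheta (𝔭 : Primes Φt) :
    ordAt 𝔭 chainPrimeData.divTheta = if idx 𝔭 = Sum.inl 0 then 1 else 0 := by
  change ordAt 𝔭 (Algebra.GrothendieckGroup.of (xinl 0)) = _
  rw [ordAt_of]
  by_cases h : idx 𝔭 = Sum.inl 0
  · rw [if_pos h, h, DirectSum.single_apply_same]; rfl
  · rw [if_neg h, DirectSum.single_apply_of_ne h]; rfl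

/-- **The binders of the order form hold at the chain model**, for every `e = reindex (chainAut ε c)`: separating orders,
transport under `Ψ^Φ_{A_⊚}`, profile `θ = 𝟙_{0}` symmetric about `s = 0`, cusp orders `κ = 0`, `hAut` (orders transported,
cusps preserved, labels moved by `(1, g⁻¹)`), `htrans` (all translations realised).
[cite: MochizukiEtTh2009, Prop 5.3 (vi) p.326 (PDF p.100); proof p.327 (PDF p.101)] -/
theorem orders_binders_chain (ε : ℤˣ) (c : ℤ) :
    ∃ (ord : Primes chainTheta.PhiAcirc → Algebra.GrothendieckGroup chainTheta.PhiAcirc → ℚ) (κ : ℚ) (θ : ℤ → ℚ) (s : ℤ),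
      (∀ x y, (∀ 𝔭, ord 𝔭 x = ord 𝔭 y) → x = y) ∧
      (∀ 𝔮 x, ord 𝔮 (ThetaFrobenioid.gpMap (psiPhi chainTheta Ψ₁ ι₁ (reindex (chainAut ε c)) :
          chainTheta.PhiAcirc →* chainTheta.PhiAcirc) x) =
        ord (Primes.congr (psiPhi chainTheta Ψ₁ ι₁ (reindex (chainAut ε c))).symm 𝔮) x) ∧
      (∀ j, θ (s - j) = θ j) ∧
      (∀ 𝔠, chainPrimeData.IsCuspidal 𝔠 → ord 𝔠 chainPrimeData.divTheta = κ) ∧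
      (∀ (𝔫 : Primes chainTheta.PhiAcirc) (h𝔫 : ¬ chainPrimeData.IsCuspidal 𝔫),
        ord 𝔫 chainPrimeData.divTheta = θ (chainPrimeData.ncspEquivZ ⟨𝔫, h𝔫⟩)) ∧
      (∀ g : Aut chainTheta.Acirc,
        (∀ 𝔮 x, ord 𝔮 (ThetaFrobenioid.gpMap (chainTheta.pullAut g : chainTheta.PhiAcirc →* chainTheta.PhiAcirc) x) =
          ord (Primes.congr (chainTheta.pullAut g).symm 𝔮) x) ∧
        (∀ 𝔭, chainPrimeData.IsCuspidal (Primes.congr (chainTheta.pullAut g) 𝔭) ↔ chainPrimeData.IsCuspidal 𝔭) ∧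
        ∃ (ε' : ℤˣ) (c' : ℤ), ∀ (𝔭 : Primes chainTheta.PhiAcirc) (h𝔭 : ¬ chainPrimeData.IsCuspidal 𝔭)
          (h𝔭' : ¬ chainPrimeData.IsCuspidal (Primes.congr (chainTheta.pullAut g) 𝔭)),
          chainPrimeData.ncspEquivZ ⟨Primes.congr (chainTheta.pullAut g) 𝔭, h𝔭'⟩ =
            ε' * chainPrimeData.ncspEquivZ ⟨𝔭, h𝔭⟩ + c') ∧
      (∀ t : ℤ, ∃ g : Aut chainTheta.Acirc,
        (∀ 𝔭, chainPrimeData.IsCuspidal (Primes.congr (chainTheta.pullAut g) 𝔭) ↔ chainPrimeData.IsCuspidal 𝔭) ∧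
        ∀ (𝔭 : Primes chainTheta.PhiAcirc) (h𝔭 : ¬ chainPrimeData.IsCuspidal 𝔭)
          (h𝔭' : ¬ chainPrimeData.IsCuspidal (Primes.congr (chainTheta.pullAut g) 𝔭)),
          chainPrimeData.ncspEquivZ ⟨Primes.congr (chainTheta.pullAut g) 𝔭, h𝔭'⟩ =
            chainPrimeData.ncspEquivZ ⟨𝔭, h𝔭⟩ + t) := by
  have hpull : ∀ g : Aut chainTheta.Acirc, chainTheta.pullAut g = reindex (shift (Multiplicative.toAdd g.inv)) :=
    fun g => MulEquiv.ext (pullAut_chain g)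
  refine ⟨ordAt, 0, fun j => if j = 0 then 1 else 0, 0, ordAt_separating,
    ordAt_gpMap_reindex (chainAut ε c) _ (psiPhi_chain _), fun j => by simp, fun 𝔠 h𝔠 => ?_, fun 𝔫 h𝔫 => ?_,
    fun g => ⟨ordAt_gpMap_reindex _ _ (hpull g), isCusp_congr_chainAut 1 _ _ (hpull g), 1, Multiplicative.toAdd g.inv,
      fun 𝔭 h𝔭 _ => ?_⟩, fun t => ?_⟩
  · obtain ⟨n, hn⟩ := h𝔠
    rw [ordAt_divTheta, if_neg (by rw [hn]; exact Sum.inr_ne_inl)]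
  · obtain ⟨n, hn⟩ := idx_eq_inl_of_not_isCusp h𝔫
    change ordAt 𝔫 _ = if label 𝔫 = 0 then (1 : ℚ) else 0
    rw [ordAt_divTheta, hn, label_of_idx (Or.inl hn)]
    simp
  · obtain ⟨n, hn⟩ := idx_eq_inl_of_not_isCusp h𝔭
    exact label_congr_chainAut 1 _ _ (hpull g) hn
  · obtain ⟨g, hg⟩ := exists_aut_translate t
    refine ⟨g, isCusp_congr_chainAut 1 _ _ (hpull g), fun 𝔭 h𝔭 _ => ?_⟩
    obtain ⟨n, hn⟩ := idx_eq_inl_of_not_isCusp h𝔭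
    exact (label_congr_chainAut 1 _ _ (hpull g) hn).trans (by rw [Units.val_one, one_mul, hg]; rfl)

/-- (vi) at the chain model THROUGH the order form `preservesThetaDivisorOrbit_of_orders` (p437011).
[cite: MochizukiEtTh2009, Prop 5.3 (vi) p.326 (PDF p.100)] -/
theorem preservesThetaDivisorOrbit_chain_viaOrders (ε : ℤˣ) (c : ℤ) :
    Literature.AnabelianGeometry.EtaleTheta.FrobenioidThetaDivisors.PreservesThetaDivisorOrbit chainPrimeData Ψ₁ ι₁
      (reindex (chainAut ε c)) := by
  obtain ⟨ord, κ, θ, s, hsep, hψo, hθ, hcusp, hdiv, hAut, htrans⟩ := orders_binders_chain ε c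
  exact preservesThetaDivisorOrbit_of_orders chainPrimeData Ψ₁ ι₁ _ ord hsep (cuspPreserved_chain ε c)
    (preservesNcspLabels_chain ε c) hψo κ θ s hθ hcusp hdiv hAut htrans

end Literature.AnabelianGeometry.EtaleTheta.FrobenioidThetaDivisors.Prop53Chain
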